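import Summits.FinalStateConjecture.FinalStateConjecture.Theorems.BartnikGapSettlingBondiBartnikRigidityStationaryKerrCollarRoute
import Literature.Geometry.Lorentzian.KerrSchildDivergence
import Literature.Geometry.Lorentzian.OpensCausality
import Literature.Geometry.Lorentzian.CausalityChronologyProofs
import HarnessLib

/-!
# F6 `KerrLateBoxPlacement` (stub `stub_kerrLateBoxPlacement`, K2c) — line `direct-method-on-the-cone`
# (crux `BondiBartnikRigidity`, stmt-FinalStateConjecture-10807)

In the Kerr star chart `Kerr.spacetime M a M` (`{r > M}`, ingoing Kerr–Schild Cartesian coordinates,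
`0 < M`, `|a| < M`) every late coordinate box `{τ < t* < τ + T, M < r < R + 1}`, `τ = 9|R + 1| + 6M`,
lies in the open causal future `J⁺(slab)°` of the thick slab `{t* = 0, r ≤ 3M}`; hence the route
statement `K2Route.KerrLateBoxPlacement` (F6 of the checked reduction `K2Route.K2_of_route`).

Proof (explicit straight timelike lines, no ODEs).  The principal null congruence `ℓ♯` of the
Kerr–Schild form consists of straight lines of the flat coordinates along which `r` grows at unit
rate and `ℓ♯` is constant (`Kerr.radius_add_smul_nullVector`, `Kerr.nullVector_add_smul_nullVector`),
and all components are `t*`-independent.  Hence along the straight line `s ↦ x + s w`,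
`w = ∂₀ + λ ℓ♯ₓ`, one has `r = r(x) + λ s`, `ℓ♯ ≡ ℓ♯ₓ` and
`g(w, w) = η(w, w) + 2H ℓ(w)² = −1 + 2λ + 2H`, `H ≤ M/r` (`kerrLine_radius`, `kerrLine_bilin`):
the INGOING direction `∂₀ − ℓ♯` (`λ = −1`) is timelike on all of `{r > M}`, the slightly outgoing
direction `∂₀ + ℓ♯/10` on `{r ≥ 13M/5}`, and `∂₀` itself on `{r > 2M}`; all have `w⁰ = 1 − λ > 0`,
i.e. are future-directed for `−g♯dt*` (`g(−g♯dt*, w) = −w⁰`).  A point `y` of the box is reached from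
the slab point below a shell point `q₁` (`r(q₁) ∈ {11M/4, 13M/5} ⊆ (2M, 3M]`) by the `∂₀`-line
followed by one such line (`mem_chronologicalFuture_slabK`); straight timelike chart segments realise
`≪` (`mem_chronologicalFuture_of_segment`), `≪` is transitive (`mem_chronologicalFuture_trans`),
`I⁺ ⊆ J⁺`, and the box is open, so it lies in the interior of `J⁺(slab)`.

References: Kerr–Schild 1965, §2 (the congruence is geodesic and shear-free in the flat background)
[KerrSchild1965]; Dafermos–Rodnianski arXiv:0811.0354, §5.1 (the Kerr star chart) [DafermosRodnianski2008];
O'Neill 1983, Ch. 14, pp. 402–403 (`I⁺`, `J⁺`, transitivity) [ONeill1983]; O'Neill 1995, Ch. 2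
[ONeill1995].
-/

noncomputable section

-- D-0017: single-problem summit, `Summit.<S>.<S>.…` by design (cf. lakefile `weak.linter.dupNamespace`).
set_option linter.dupNamespace false
-- instance search through the nested operator types of the Kerr chart facts
set_option maxSynthPendingDepth 3

open Set Filter Function Topology TopologicalSpace
open Literature.Geometry.Lorentzian
open scoped Manifold ContDiff Topology

namespace Summit.FinalStateConjecture.FinalStateConjecture.Theorems.BondiBartnikRigidity.DirectMethod

namespace KerrLateBox

/-! ### The straight lines `s ↦ x + s (∂₀ + λ ℓ♯ₓ)` of the Kerr–Schild chart -/

/-- The line point `x + s (∂₀ + λ ℓ♯ₓ)` is the null-line point `x + (λ s) ℓ♯ₓ` translated by `s ∂₀`.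
[folklore] -/
theorem kerrLine_eq (a : ℝ) (x : E4) (l s : ℝ) :
    x + s • (E4.basisVector 0 + l • Kerr.nullVector a x) =
      (x + (l * s) • Kerr.nullVector a x) + s • E4.basisVector 0 := by
  rw [smul_add, smul_smul, mul_comm s l]
  abel

/-- **Radius `r(x) + λ s`, null vector `ℓ♯ₓ` and null covector `ℓₓ` along the line
`x + s (∂₀ + λ ℓ♯ₓ)`** (while `r(x) + λ s > 0`): the principal null lines are straight, `r` grows at
unit rate and `ℓ` is constant along them, and everything is `t*`-independent.
[cite: KerrSchild1965, §2] -/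
theorem kerrLine_radius {a : ℝ} {x : E4} (hx : 0 < Kerr.radius a x) (l s : ℝ)
    (hs : 0 < Kerr.radius a x + l * s) :
    Kerr.radius a (x + s • (E4.basisVector 0 + l • Kerr.nullVector a x)) = Kerr.radius a x + l * s ∧
    Kerr.nullVector a (x + s • (E4.basisVector 0 + l • Kerr.nullVector a x)) = Kerr.nullVector a x ∧
    Kerr.nullCovector a (x + s • (E4.basisVector 0 + l • Kerr.nullVector a x)) =
      Kerr.nullCovector a x := by
  rw [kerrLine_eq, Kerr.radius_add_time_smul_basisVector, Kerr.nullVector_add_smul_basisVector_zero,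
    Kerr.nullCovector_add_smul_basisVector_zero, Kerr.radius_add_smul_nullVector hx hs,
    Kerr.nullVector_add_smul_nullVector hx hs]
  refine ⟨rfl, rfl, ?_⟩
  unfold Kerr.nullCovector
  rw [show Kerr.nullCovectorFun a (x + (l * s) • Kerr.nullVector a x) = Kerr.nullCovectorFun a x from
    funext (Kerr.nullCovectorFun_add_smul_nullVector hx hs)]

/-- Time coordinate `x⁰ + s (1 − λ)` along the line (`(ℓ♯)⁰ = −1`). [folklore] -/
theorem kerrLine_apply_zero (a : ℝ) (x : E4) (l s : ℝ) :
    (x + s • (E4.basisVector 0 + l • Kerr.nullVector a x)) 0 = x 0 + s * (1 - l) := by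
  simp [Kerr.nullVector_apply_zero]
  ring

/-- **`g(w, w) = −1 + 2λ + 2H` along the line**, `w = ∂₀ + λ ℓ♯ₓ`: `ℓ(w) = ℓ(∂₀) = 1` and
`η(w, w) = −1 + 2λ ℓ(∂₀) + λ² ℓ(ℓ♯) = −1 + 2λ`. [cite: KerrSchild1965, §2] -/
theorem kerrLine_bilin (M : ℝ) {a : ℝ} {x : E4} (hx : 0 < Kerr.radius a x) (l s : ℝ)
    (hs : 0 < Kerr.radius a x + l * s) :
    Kerr.bilin M a (x + s • (E4.basisVector 0 + l • Kerr.nullVector a x))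
      (E4.basisVector 0 + l • Kerr.nullVector a x) (E4.basisVector 0 + l • Kerr.nullVector a x) =
      -1 + 2 * l + 2 * Kerr.scalarH M a (x + s • (E4.basisVector 0 + l • Kerr.nullVector a x)) := by
  rw [Kerr.bilin_apply, (kerrLine_radius hx l s hs).2.2]
  simp only [map_add, map_smul, add_apply, FunLike.coe_smul,
    Pi.smul_apply, smul_eq_mul, Minkowski.bilin_basisVector_zero, Kerr.bilin_nullVector,
    Kerr.bilin_nullVector_right, Kerr.nullCovector_basisVector_zero, Kerr.nullCovector_nullVector hx]
  ring

/-- **`w = ∂₀ + λ ℓ♯ₓ` is `g`-timelike along the line as soon as `M < (1/2 − λ)(r(x) + λ s)`**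
(`H ≤ M/r`, `Kerr.scalarH_le_div`). [cite: DafermosRodnianski2008, §5.1] -/
theorem kerrLine_bilin_neg {M a : ℝ} (hM : 0 < M) {x : E4} (hx : 0 < Kerr.radius a x) (l s : ℝ)
    (hs : 0 < Kerr.radius a x + l * s) (h : M < (1 / 2 - l) * (Kerr.radius a x + l * s)) :
    Kerr.bilin M a (x + s • (E4.basisVector 0 + l • Kerr.nullVector a x))
      (E4.basisVector 0 + l • Kerr.nullVector a x) (E4.basisVector 0 + l • Kerr.nullVector a x) < 0 := by
  rw [kerrLine_bilin M hx l s hs]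
  have hr := (kerrLine_radius hx l s hs).1
  have hH := Kerr.scalarH_le_div hM.le a (x := x + s • (E4.basisVector 0 + l • Kerr.nullVector a x))
    (by rw [hr]; exact hs)
  rw [hr, le_div_iff₀ hs] at hH
  nlinarith

/-! ### Straight timelike chart segments realise `≪` -/

/-- **Straight timelike chart segments realise `I⁺`.** If the chart segment `s ↦ p + s w`,
`s ∈ [0, S]`, `S > 0`, stays in the chart `{r > M}`, and its direction has `w⁰ > 0` and is
`g`-timelike at each of its points, then its endpoint `q = p + S w` lies in `I⁺({p})`: the segment,
extended by `p` off the chart, is a future timelike curve of the chart on `[0, S]` (its chart velocity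
is `w`, `d(Subtype.val) = id`; future-directed since `g(−g♯dt*, w) = −w⁰ < 0`).
[cite: ONeill1983, Ch. 14, pp. 402–403] -/
theorem mem_chronologicalFuture_of_segment [Kerr.Facts] {M a : ℝ} (hM : 0 < M)
    (p q : Kerr.region a M) (w : E4) {S : ℝ} (hS : 0 < S) (hq : (q : E4) = p + S • w)
    (hmem : ∀ s ∈ Icc (0 : ℝ) S, (p : E4) + s • w ∈ Kerr.region a M)
    (htl : ∀ s ∈ Icc (0 : ℝ) S, Kerr.bilin M a ((p : E4) + s • w) w w < 0) (h0 : 0 < w 0) :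
    q ∈ (Kerr.smoothMetric M a M).chronologicalFuture
      ((Kerr.timeOrientation M a M hM.le).ofLE le_top) {p} := by
  classical
  set L : ℝ → E4 := fun s ↦ (p : E4) + s • w with hL
  set γ : ℝ → Kerr.region a M := fun s ↦ if h : L s ∈ Kerr.region a M then ⟨L s, h⟩ else p with hγ
  have hLd : ∀ s, HasDerivAt L w s := fun s ↦ by
    have h := ((hasDerivAt_id s).smul_const w).const_add (p : E4)
    rwa [one_smul] at h
  have hO : IsOpen (L ⁻¹' (Kerr.region a M : Set E4)) :=
    (Kerr.region a M).2.preimage (continuous_const.add (continuous_id.smul continuous_const))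
  have hγL : ∀ s, L s ∈ Kerr.region a M → (γ s : E4) = L s := fun s h ↦ by
    simp only [hγ, dif_pos h]
  have hcurve : (Kerr.smoothMetric M a M).IsFutureTimelikeCurveOn
      ((Kerr.timeOrientation M a M hM.le).ofLE le_top) γ (Icc 0 S) := by
    intro s hs
    have hsm := hmem s hs
    have hev : (fun s' ↦ (γ s' : E4)) =ᶠ[𝓝 s] L :=
      Filter.eventuallyEq_of_mem (hO.mem_nhds hsm) fun s' h ↦ hγL s' h
    have hd : HasDerivAt (fun s' ↦ (γ s' : E4)) w s := (hLd s).congr_of_eventuallyEq hev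
    have hmd : MDifferentiableAt 𝓘(ℝ, ℝ) 𝓘(ℝ, E4) γ s :=
      (mdifferentiableAt_subtypeVal_comp_curve_iff (I := 𝓘(ℝ, E4)) (Kerr.region a M)).1
        (mdifferentiableAt_iff_differentiableAt.2 hd.differentiableAt)
    have hv : (velocity 𝓘(ℝ, E4) γ s : E4) = w := by
      rw [← velocity_subtypeVal_comp (I := 𝓘(ℝ, E4)) (Kerr.region a M) γ s]
      unfold velocity
      rw [mfderiv_eq_fderiv]
      exact hd.deriv
    have hx : 0 < Kerr.radius a (γ s) := Kerr.radius_pos_of_mem_region (γ s).2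
    have hpt : (γ s : E4) = L s := hγL s hsm
    have htl' : Kerr.bilin M a (γ s) w w < 0 := by rw [hpt]; exact htl s hs
    have hne : w ≠ 0 := fun h ↦ by rw [h] at h0; simp at h0
    refine ⟨hmd, ?_, ⟨?_, ?_⟩, ?_⟩
    · change Kerr.bilin M a (γ s) (velocity 𝓘(ℝ, E4) γ s) (velocity 𝓘(ℝ, E4) γ s) < 0
      rw [hv]; exact htl'
    · change Kerr.bilin M a (γ s) (velocity 𝓘(ℝ, E4) γ s) (velocity 𝓘(ℝ, E4) γ s) ≤ 0
      rw [hv]; exact htl'.le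
    · intro h; exact hne (hv.symm.trans h)
    · change Kerr.bilin M a (γ s) (Kerr.timeVector M a (γ s)) (velocity 𝓘(ℝ, E4) γ s) < 0
      rw [Kerr.bilin_timeVector hx, hv]
      linarith
  have hγ0 : γ 0 = p := by
    have hL0 : L 0 = p := by simp [hL]
    exact Subtype.ext ((hγL 0 (by rw [hL0]; exact p.2)).trans hL0)
  have hγ1 : γ S = q := by
    have hL1 : L S = q := hq.symm
    exact Subtype.ext ((hγL S (by rw [hL1]; exact q.2)).trans hL1)
  exact ⟨p, rfl, γ, 0, S, hS, hcurve, hγ0, hγ1⟩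

/-! ### The two-leg chain: slab point, `∂₀`-line on a shell, straight timelike line to `y` -/

/-- **From the slab to a chart point by two straight timelike legs.** Let `y` be a chart point,
`w = ∂₀ + λ ℓ♯_y` (`λ < 1`), `S > 0`, such that the backward line `y + s w`, `s ∈ [−S, 0]`, stays in
`{r > M}` with `M < (1/2 − λ) r` along it (so that `w` is `g`-timelike there), the shell radius
`r(y) − λ S` of its initial point `q₁ = y − S w` lies in `(2M, 3M]`, and `y⁰ > S (1 − λ)`.  Then
`y ∈ I⁺(slab)`: the slab point `p₀ = q₁ − q₁⁰ ∂₀` (`q₁⁰ = y⁰ − S(1 − λ) > 0`) is joined to `q₁` by its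
`∂₀`-line (timelike: `g(∂₀, ∂₀) = −1 + 2H < 0` for `r > 2M`) and `q₁` to `y` by the line of direction
`w`; conclude by transitivity of `≪`. [cite: ONeill1983, Ch. 14, pp. 402–403] -/
theorem mem_chronologicalFuture_slabK [Kerr.Facts] {M a : ℝ} (hM : 0 < M) (y : Kerr.region a M)
    {l S : ℝ} (hl : l < 1) (hS : 0 < S)
    (hreg : ∀ s ∈ Icc (-S) 0, M < Kerr.radius a y + l * s)
    (htl : ∀ s ∈ Icc (-S) 0, M < (1 / 2 - l) * (Kerr.radius a y + l * s))
    (hshell₁ : 2 * M < Kerr.radius a y - l * S) (hshell₂ : Kerr.radius a y - l * S ≤ 3 * M)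
    (htime : S * (1 - l) < (y : E4) 0) :
    y ∈ (Kerr.smoothMetric M a M).chronologicalFuture
      ((Kerr.timeOrientation M a M hM.le).ofLE le_top) (slabK M a) := by
  have hy : 0 < Kerr.radius a y := Kerr.radius_pos_of_mem_region y.2
  set w : E4 := E4.basisVector 0 + l • Kerr.nullVector a y with hw
  -- the backward line `y + s w`, `s ∈ [-S, 0]`
  have hpos : ∀ s ∈ Icc (-S) 0, 0 < Kerr.radius a y + l * s := fun s hs ↦ hM.trans (hreg s hs)
  have hmem : ∀ s ∈ Icc (-S) 0, (y : E4) + s • w ∈ Kerr.region a M := fun s hs ↦ by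
    rw [Kerr.mem_region, max_eq_left hM.le, hw, (kerrLine_radius hy l s (hpos s hs)).1]
    exact hreg s hs
  have hSm : -S ∈ Icc (-S) 0 := ⟨le_rfl, by linarith⟩
  -- the shell point `q₁ = y - S w`
  set q₁ : Kerr.region a M := ⟨(y : E4) + (-S) • w, hmem (-S) hSm⟩ with hq₁
  have hrq : Kerr.radius a (q₁ : E4) = Kerr.radius a y - l * S := by
    show Kerr.radius a ((y : E4) + (-S) • w) = _
    rw [hw, (kerrLine_radius hy l (-S) (hpos (-S) hSm)).1]
    ring
  have htq : (q₁ : E4) 0 = (y : E4) 0 - S * (1 - l) := by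
    show ((y : E4) + (-S) • w) 0 = _
    rw [hw, kerrLine_apply_zero]
    ring
  have hrq0 : 0 < Kerr.radius a (q₁ : E4) := Kerr.radius_pos_of_mem_region q₁.2
  have hshift : ∀ s : ℝ, (q₁ : E4) + s • w = (y : E4) + (s - S) • w := fun s ↦ by
    show ((y : E4) + (-S) • w) + s • w = _
    rw [add_assoc, ← add_smul]
    ring_nf
  -- leg 2 : `q₁ ≪ y`
  have h2 : y ∈ (Kerr.smoothMetric M a M).chronologicalFuture
      ((Kerr.timeOrientation M a M hM.le).ofLE le_top) {q₁} := by
    refine mem_chronologicalFuture_of_segment hM q₁ y w hS (by rw [hshift]; simp)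
      (fun s hs ↦ ?_) (fun s hs ↦ ?_)
      (by rw [hw]; simp [Kerr.nullVector_apply_zero]; linarith)
    · rw [hshift]
      exact hmem (s - S) ⟨by linarith [hs.1], by linarith [hs.2]⟩
    · rw [hshift, hw]
      exact kerrLine_bilin_neg hM hy l (s - S) (hpos (s - S) ⟨by linarith [hs.1], by linarith [hs.2]⟩)
        (htl (s - S) ⟨by linarith [hs.1], by linarith [hs.2]⟩)
  -- the slab point `p₀ = q₁ - t₁ ∂₀`
  set t₁ : ℝ := (y : E4) 0 - S * (1 - l) with ht₁_def
  have ht₁ : 0 < t₁ := by rw [ht₁_def]; linarith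
  have hp₀mem : (q₁ : E4) + (-t₁) • E4.basisVector 0 ∈ Kerr.region a M := by
    rw [Kerr.mem_region, max_eq_left hM.le, Kerr.radius_add_time_smul_basisVector, hrq]
    linarith
  set p₀ : Kerr.region a M := ⟨(q₁ : E4) + (-t₁) • E4.basisVector 0, hp₀mem⟩ with hp₀
  have hp₀slab : p₀ ∈ slabK M a := by
    constructor
    · show ((q₁ : E4) + (-t₁) • E4.basisVector 0) 0 = 0
      simp [htq, ht₁_def]
    · show Kerr.radius a ((q₁ : E4) + (-t₁) • E4.basisVector 0) ≤ 3 * M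
      rw [Kerr.radius_add_time_smul_basisVector, hrq]
      exact hshell₂
  have hshift₀ : ∀ s : ℝ, (p₀ : E4) + s • E4.basisVector 0 = (q₁ : E4) + (s - t₁) • E4.basisVector 0 :=
    fun s ↦ by
    show ((q₁ : E4) + (-t₁) • E4.basisVector 0) + s • E4.basisVector 0 = _
    rw [add_assoc, ← add_smul]
    ring_nf
  -- leg 1 : `p₀ ≪ q₁`
  have h1 : q₁ ∈ (Kerr.smoothMetric M a M).chronologicalFuture
      ((Kerr.timeOrientation M a M hM.le).ofLE le_top) {p₀} := by
    refine mem_chronologicalFuture_of_segment hM p₀ q₁ (E4.basisVector 0) ht₁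
      (by rw [hshift₀]; simp) (fun s _ ↦ ?_) (fun s _ ↦ ?_) (by simp)
    · rw [hshift₀, Kerr.mem_region, max_eq_left hM.le, Kerr.radius_add_time_smul_basisVector, hrq]
      linarith
    · rw [hshift₀, Kerr.bilin_add_smul_basisVector_zero, Kerr.bilin_apply,
        Minkowski.bilin_basisVector_zero, Kerr.nullCovector_basisVector_zero]
      have hH := Kerr.scalarH_le_div hM.le a hrq0
      rw [hrq, le_div_iff₀ (by linarith)] at hH
      nlinarith
  exact LorentzianMetric.mem_chronologicalFuture_trans
    (LorentzianMetric.chronologicalFuture_mono (singleton_subset_iff.2 hp₀slab) h1) h2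

/-! ### The placement -/

/-- The coordinate boxes `boxK` of the chart are open (`t*` and `r` are continuous). [folklore] -/
theorem isOpen_boxK [Kerr.Facts] (M a τ₁ τ₂ r₁ r₂ : ℝ) : IsOpen (boxK M a τ₁ τ₂ r₁ r₂) := by
  have h0 : Continuous fun y : Kerr.region a M ↦ (y : E4) 0 :=
    (PiLp.continuous_apply 2 _ 0).comp continuous_subtype_val
  have hr : Continuous fun y : Kerr.region a M ↦ Kerr.radius a (y : E4) :=
    (Kerr.continuous_radius a).comp continuous_subtype_val
  exact (isOpen_lt continuous_const h0).inter ((isOpen_lt h0 continuous_const).inter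
    ((isOpen_lt continuous_const hr).inter (isOpen_lt hr continuous_const)))

/-- **Late boxes lie in `J⁺(slab)`**: every chart point `y` with `y⁰ > 9|R + 1| + 6M` and
`M < r(y) < R + 1` is in `I⁺(slab) ⊆ J⁺(slab)` — for `r(y) < 11M/4` by the chain with the INGOING
direction `∂₀ − ℓ♯` (`λ = −1`, timelike on all of `{r > M}`) back up to the shell `r = 11M/4`, for
`r(y) ≥ 11M/4` with the slightly OUTGOING direction `∂₀ + ℓ♯/10` (timelike on `{r ≥ 13M/5}`) back
down to the shell `r = 13M/5`; the shell point has positive time since `y⁰ > 9|R + 1| + 6M` exceeds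
the duration `2(11M/4 − r)` resp. `9(r − 13M/5)` of the second leg. [cite: DafermosRodnianski2008, §5.1] -/
theorem boxK_subset_JK [Kerr.Facts] {M a : ℝ} (hM : 0 < M) (R T : ℝ) :
    boxK M a (9 * |R + 1| + 6 * M) (9 * |R + 1| + 6 * M + T) M (R + 1) ⊆ JK M a hM (slabK M a) := by
  rintro y ⟨hτ, -, hry, hryR⟩
  have hR : R + 1 ≤ |R + 1| := le_abs_self _
  have hR0 : 0 ≤ |R + 1| := abs_nonneg _
  change y ∈ (Kerr.smoothMetric M a M).causalFuture ((Kerr.timeOrientation M a M hM.le).ofLE le_top)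
    (slabK M a)
  refine LorentzianMetric.chronologicalFuture_subset_causalFuture _ _ _ ?_
  rcases lt_or_ge (Kerr.radius a (y : E4)) (11 * M / 4) with hr | hr
  · -- ingoing leg, `λ = -1`, back up to the shell `r = 11M/4`
    exact mem_chronologicalFuture_slabK hM y (l := -1) (S := 11 * M / 4 - Kerr.radius a (y : E4))
      (by norm_num) (by linarith) (fun s hs ↦ by linarith [hs.2]) (fun s hs ↦ by nlinarith [hs.2])
      (by linarith) (by linarith) (by linarith)
  · -- outgoing leg, `λ = 1/10`, back down to the shell `r = 13M/5`
    exact mem_chronologicalFuture_slabK hM y (l := 1 / 10)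
      (S := 10 * (Kerr.radius a (y : E4) - 13 * M / 5))
      (by norm_num) (by linarith) (fun s hs ↦ by linarith [hs.1]) (fun s hs ↦ by nlinarith [hs.1])
      (by linarith) (by linarith) (by nlinarith)

end KerrLateBox

open KerrLateBox in
/-- **Registered sub-goal `stub_kerrLateBoxPlacement` (F6 `K2Route.KerrLateBoxPlacement` of the checked
reduction of K2).**  In the Kerr star chart `{r > M}`, `0 < M`, `|a| < M`: for all `R, T`, with
`τ = 9|R + 1| + 6M`, `ρ = R + 1`, `T₀ = τ + T`, the late box `{τ < t* < τ + T, M < r < R + 1}` lies in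
`J⁺(slab)° ∩ {t* < T₀, r < ρ}` — the open box lies in `J⁺(slab)` (`boxK_subset_JK`: two straight
timelike legs from the slab through a shell point), hence in its interior.
[cite: DafermosRodnianski2008, §5.1] -/
theorem stub_kerrLateBoxPlacement : K2Route.KerrLateBoxPlacement := by
  intro _ M a R T hM _
  refine ⟨9 * |R + 1| + 6 * M, R + 1, 9 * |R + 1| + 6 * M + T, fun y hy ↦ ⟨?_, hy.2.1, hy.2.2.2⟩⟩
  exact interior_maximal (boxK_subset_JK hM R T) (isOpen_boxK M a _ _ _ _) hy

end Summit.FinalStateConjecture.FinalStateConjecture.Theorems.BondiBartnikRigidity.DirectMethod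

end
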